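import Literature.NumberTheory.LFunctions.ClassGroupLFunctionExceptionalZeroQuadraticField
import Literature.NumberTheory.LFunctions.NoRealZeroUpTo
import HarnessLib

/-!
# A no-exceptional-zero table up to `Q` clears the exceptional zero of every real class group
# `L`-function (and of `ζ_K`) of every number field with `|d_K| ≤ Q`

Topic `Literature/NumberTheory/LFunctions`, namespace `Literature.NumberTheory.LFunctions.NumberField`.
Theorem-only file (no definition, no named fact, no `sorry`). The finite-range companion of
`ClassGroupLFunctionExceptionalZeroOfNoSiegel.lean` (there: the open statement `NoSiegelZeros` ⇒ no
exceptional zero in any degree); here the hypothesis is the criterion of a certified table,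
`NoExceptionalZeroUpTo Q c₀` / `NoRealZeroUpTo Q` (`NoExceptionalZeroUpTo.lean`, `NoRealZeroUpTo.lean`),
and every conclusion carries `|d_K| ≤ Q`.

**Theorem** (`classGroupLFunction_ne_zero_of_noExceptionalZeroUpTo`). Assume `NoExceptionalZeroUpTo Q c₀`
with `c₀ > 0`. Then for EVERY number field `K` of degree `n > 1` with `|d_K| ≤ Q`, every real class
group character `χ` (`χ² = 1`; `χ = 1`, i.e. `ζ_K`, included) and every real `σ` with
`1 − min(c₀, 1)/(8·(2n)!·log|d_K|) ≤ σ < 1`: `L(σ, χ) ≠ 0`.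

Proof: a zero in Stark's window `[1 − 1/(8(2n)! log|d_K|), 1)` is a zero `L(σ, κ) = 0` of a PRIMITIVE
quadratic Dirichlet character `κ` mod `M`, `3 ≤ M ≤ |d_K|` (tree:
`exists_dirichletCharacter_realZero_of_classGroupLFunction_eq_zero` — Stark's descent to a quadratic
subfield of the quadratic class field of `χ`, class field theory of the tree), and
`1 − c₀/log M ≤ 1 − c₀/log|d_K| ≤ σ`, `σ > 0`, `M ≤ Q`: excluded by the table.

**Corollaries.** `dedekindZetaCont_ne_zero_of_noExceptionalZeroUpTo` (`χ = 1`);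
`classGroupLFunction_ne_zero_of_noRealZeroUpTo` / `dedekindZetaCont_ne_zero_of_noRealZeroUpTo` — under
the WIDE table the whole Stark window `[1 − 1/(8(2n)! log|d_K|), 1)` is zero-free. This is the
input the Linnik-range Mertens / class-PNT theorems of the tree take "in the no-Siegel-zero case" for
fields WITH a small quadratic subfield (the column's consumer C4), now for `|d_K| ≤ Q` without any
hypothesis beyond the table.

## References

* H. M. Stark, *Some effective cases of the Brauer–Siegel theorem*, Invent. Math. 23 (1974) 135–152,
  Thm. 3. [Stark1974]
* J. Thorner, A. Zaman, *A unified and improved Chebotarev density theorem*, Algebra Number Theory 13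
  (2019), Thm. 1.4 and §3. [ThornerZaman2019]
* R. F. Lu, A. Zaman, H. Zhao, Math. Comp. (2026), doi:10.1090/mcom/4268, Theorem 1.1 (a table to
  `Q = 10¹⁰`, `c₀ = 1/5`). [LuZamanZhao2026]
-/

noncomputable section

open scoped NumberField nonZeroDivisors
open Complex NumberField Module

namespace Literature.NumberTheory.LFunctions.NumberField

open Literature.NumberTheory.LFunctions

/-- **A narrow table clears the exceptional zero of class group `L`-functions, every degree.** Under
`NoExceptionalZeroUpTo Q c₀` (`c₀ > 0`): for every number field `K` of degree `n > 1` with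
`|d_K| ≤ Q`, every class group character `χ` with `χ² = 1` and every real `σ` with
`1 − min(c₀, 1)/(8·(2n)!·log|d_K|) ≤ σ < 1`, `L(σ, χ) ≠ 0`. (Stark's descent: such a zero would be a
zero of `L(s, κ)`, `κ` primitive quadratic mod `M`, `3 ≤ M ≤ |d_K| ≤ Q`, inside the table's window.)
[cite: Stark1974, Thm. 3] [cite: ThornerZaman2019, Thm. 1.4 and §3] -/
theorem classGroupLFunction_ne_zero_of_noExceptionalZeroUpTo {Q : ℕ} {c₀ : ℝ}
    (hN : NoExceptionalZeroUpTo Q c₀) (hc₀ : 0 < c₀) (K : Type) [Field K] [NumberField K]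
    (hK : 1 < finrank ℚ K) (hdQ : (discr K).natAbs ≤ Q) (χ : ClassGroup (𝓞 K) →* ℂˣ)
    (hχ : χ * χ = 1) {σ : ℝ}
    (hσ : 1 - min c₀ 1 / (8 * ((2 * finrank ℚ K).factorial : ℝ) * Real.log ((discr K).natAbs : ℝ)) ≤ σ)
    (hσ1 : σ < 1) : classGroupLFunction K χ σ ≠ 0 := by
  intro h0
  set n : ℕ := finrank ℚ K with hn
  have hdK : 3 ≤ (discr K).natAbs := three_le_natAbs_discr K hK
  have hd3 : (3 : ℝ) ≤ ((discr K).natAbs : ℝ) := by exact_mod_cast hdK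
  have hlog3 : 1 < Real.log 3 := by
    have h := Real.exp_one_lt_d9
    rw [Real.lt_log_iff_exp_lt (by norm_num)]
    linarith
  have hlog : 1 < Real.log ((discr K).natAbs : ℝ) :=
    lt_of_lt_of_le hlog3 (Real.log_le_log (by norm_num) hd3)
  have hfac1 : (1 : ℝ) ≤ ((2 * n).factorial : ℝ) := by
    exact_mod_cast Nat.succ_le_of_lt (Nat.factorial_pos _)
  have hmin1 : min c₀ 1 ≤ 1 := min_le_right _ _
  have hmin0 : min c₀ 1 ≤ c₀ := min_le_left _ _
  have hminpos : 0 < min c₀ 1 := lt_min hc₀ one_pos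
  have hden : 1 < 8 * ((2 * n).factorial : ℝ) * Real.log ((discr K).natAbs : ℝ) := by nlinarith
  have hden0 : 0 < 8 * ((2 * n).factorial : ℝ) * Real.log ((discr K).natAbs : ℝ) := by linarith
  -- the hypothesis window lies inside Stark's window `[1 − 1/(8(2n)! log d), 1)`, and `σ > 0`
  have hwin : 1 - 1 / (8 * ((2 * n).factorial : ℝ) * Real.log ((discr K).natAbs : ℝ)) ≤ σ := by
    have h1 : min c₀ 1 / (8 * ((2 * n).factorial : ℝ) * Real.log ((discr K).natAbs : ℝ)) ≤
        1 / (8 * ((2 * n).factorial : ℝ) * Real.log ((discr K).natAbs : ℝ)) :=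
      div_le_div_of_nonneg_right hmin1 hden0.le
    linarith
  have hσ0 : 0 < σ := by
    have : 1 / (8 * ((2 * n).factorial : ℝ) * Real.log ((discr K).natAbs : ℝ)) < 1 := by
      rw [div_lt_one hden0]; exact hden
    linarith
  obtain ⟨M, hM0, κ, hM3, hMdvd, hκ, hsq, hprim, hLz⟩ :=
    exists_dirichletCharacter_realZero_of_classGroupLFunction_eq_zero K hK χ hχ hwin hσ1 h0
  -- `3 ≤ M ≤ |d_K| ≤ Q`, and `1 − c₀/log M ≤ 1 − c₀/log|d_K| ≤ σ`
  haveI : NeZero M := ⟨by omega⟩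
  have hMle : M ≤ (discr K).natAbs := le_of_pow_dvd_sq (by omega) (by omega) hMdvd
  have hM3' : (3 : ℝ) ≤ (M : ℝ) := by exact_mod_cast hM3
  have hlogM : 0 < Real.log (M : ℝ) := Real.log_pos (by linarith)
  have hlogMle : Real.log (M : ℝ) ≤ Real.log ((discr K).natAbs : ℝ) :=
    Real.log_le_log (by linarith) (by exact_mod_cast hMle)
  have hσM : 1 - c₀ / Real.log (M : ℝ) ≤ σ := by
    have h8F : (1 : ℝ) ≤ 8 * ((2 * n).factorial : ℝ) := by linarith
    have e : min c₀ 1 / (8 * ((2 * n).factorial : ℝ) * Real.log ((discr K).natAbs : ℝ)) =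
        min c₀ 1 / (8 * ((2 * n).factorial : ℝ)) / Real.log ((discr K).natAbs : ℝ) := by
      rw [div_div]
    have h1 : min c₀ 1 / (8 * ((2 * n).factorial : ℝ) * Real.log ((discr K).natAbs : ℝ)) ≤
        c₀ / Real.log ((discr K).natAbs : ℝ) := by
      rw [e]
      exact div_le_div_of_nonneg_right ((div_le_self hminpos.le h8F).trans hmin0) (by linarith)
    have h2 : c₀ / Real.log ((discr K).natAbs : ℝ) ≤ c₀ / Real.log (M : ℝ) :=
      div_le_div_of_nonneg_left hc₀.le hlogM hlogMle
    linarith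
  exact hN M hM3 (hMle.trans hdQ) κ (MulChar.isQuadratic_iff_sq_eq_one.mpr hsq) hprim σ hσ0 hσM
    hσ1.le hLz

/-- **The case `χ = 1`: the Dedekind zeta function.** Under `NoExceptionalZeroUpTo Q c₀` (`c₀ > 0`),
for every number field `K` of degree `n > 1` with `|d_K| ≤ Q` and every real `σ` with
`1 − min(c₀, 1)/(8·(2n)!·log|d_K|) ≤ σ < 1`: `ζ_K(σ) ≠ 0`. [cite: Stark1974, Thm. 3] -/
theorem dedekindZetaCont_ne_zero_of_noExceptionalZeroUpTo {Q : ℕ} {c₀ : ℝ}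
    (hN : NoExceptionalZeroUpTo Q c₀) (hc₀ : 0 < c₀) (K : Type) [Field K] [NumberField K]
    (hK : 1 < finrank ℚ K) (hdQ : (discr K).natAbs ≤ Q) {σ : ℝ}
    (hσ : 1 - min c₀ 1 / (8 * ((2 * finrank ℚ K).factorial : ℝ) * Real.log ((discr K).natAbs : ℝ)) ≤ σ)
    (hσ1 : σ < 1) : dedekindZetaCont K σ ≠ 0 := by
  have hne1 : ((σ : ℝ) : ℂ) ≠ 1 := by
    intro h1; apply hσ1.ne; exact_mod_cast h1
  rw [← classGroupLFunction_one K hne1]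
  exact classGroupLFunction_ne_zero_of_noExceptionalZeroUpTo hN hc₀ K hK hdQ 1 (by ext; simp) hσ hσ1

/-- **A wide table clears Stark's whole window.** Under `NoRealZeroUpTo Q` (no real zero of
`L(s, χ)` in `(0, 1)` for every quadratic primitive `χ` mod `3 ≤ q ≤ Q`): for every number field `K` of
degree `n > 1` with `|d_K| ≤ Q`, every class group character `χ` with `χ² = 1` and every real `σ` with
`1 − 1/(8·(2n)!·log|d_K|) ≤ σ < 1`, `L(σ, χ) ≠ 0` (the wide table is a narrow one of every width,
`NoRealZeroUpTo.noExceptionalZeroUpTo`; take `c₀ = 1`). [cite: Stark1974, Thm. 3]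
[cite: ThornerZaman2019, Thm. 1.4 and §3] -/
theorem classGroupLFunction_ne_zero_of_noRealZeroUpTo {Q : ℕ} (hW : NoRealZeroUpTo Q)
    (K : Type) [Field K] [NumberField K] (hK : 1 < finrank ℚ K) (hdQ : (discr K).natAbs ≤ Q)
    (χ : ClassGroup (𝓞 K) →* ℂˣ) (hχ : χ * χ = 1) {σ : ℝ}
    (hσ : 1 - 1 / (8 * ((2 * finrank ℚ K).factorial : ℝ) * Real.log ((discr K).natAbs : ℝ)) ≤ σ)
    (hσ1 : σ < 1) : classGroupLFunction K χ σ ≠ 0 := by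
  refine classGroupLFunction_ne_zero_of_noExceptionalZeroUpTo (hW.noExceptionalZeroUpTo 1) one_pos K hK
    hdQ χ hχ ?_ hσ1
  rwa [min_self]

/-- `ζ_K(σ) ≠ 0` on Stark's window `[1 − 1/(8·(2n)!·log|d_K|), 1)` for every `K` of degree `n > 1`
with `|d_K| ≤ Q`, under the wide table `NoRealZeroUpTo Q`. [cite: Stark1974, Thm. 3] -/
theorem dedekindZetaCont_ne_zero_of_noRealZeroUpTo {Q : ℕ} (hW : NoRealZeroUpTo Q)
    (K : Type) [Field K] [NumberField K] (hK : 1 < finrank ℚ K) (hdQ : (discr K).natAbs ≤ Q) {σ : ℝ}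
    (hσ : 1 - 1 / (8 * ((2 * finrank ℚ K).factorial : ℝ) * Real.log ((discr K).natAbs : ℝ)) ≤ σ)
    (hσ1 : σ < 1) : dedekindZetaCont K σ ≠ 0 := by
  refine dedekindZetaCont_ne_zero_of_noExceptionalZeroUpTo (hW.noExceptionalZeroUpTo 1) one_pos K hK
    hdQ ?_ hσ1
  rwa [min_self]

end Literature.NumberTheory.LFunctions.NumberField

end


/-! ## Appendix (append-only, 2026-08-26): the QUADRATIC-SUBFIELD form — number fields of ANY
discriminant all of whose quadratic subfields are small

Stark's located form of his Theorem 3 (`exists_quadratic_dedekindZetaCont_eq_zero`, tree file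
`StarkQuadraticSubfieldZero.lean`): a zero of `ζ_K` in `[1 − 1/(4·n!·log|d_K|), 1)` is a zero of
`ζ_k` for a QUADRATIC SUBFIELD `k ⊆ K`, i.e. (`exists_primitive_LFunction_eq_zero_of_realZero`) a zero
`L(σ, κ) = 0` of the primitive quadratic character `κ` mod `|d_k|`, and `|d_k| ≤ |d_K|`
(`natAbs_discr_pow_finrank_dvd`), so `1 − c₀/log|d_k| ≤ 1 − c₀/log|d_K| ≤ σ`. Hence a narrow table
`NoExceptionalZeroUpTo Q c₀` clears Stark's window `[1 − min(c₀, 1/(4·n!))/log|d_K|, 1)` of `ζ_K` for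
EVERY number field `K` of degree `n > 1` whose quadratic subfields all have `|d_k| ≤ Q` — with no
condition on `|d_K|`. For `K` without quadratic subfield the hypothesis is empty and this is Stark's
theorem (`Stark1974_dedekindZeta_ne_zero_of_noQuadraticSubfield_holds`); for `|d_K| ≤ Q` it contains
(and sharpens the window of) `dedekindZetaCont_ne_zero_of_noExceptionalZeroUpTo` above. This is the
input "no exceptional zero of `ζ_K`" that the Linnik-range prime ideal / Mertens theorems of the tree
take in the complementary regime of fields WITH a (small) quadratic subfield (column REALCHAR,
consumer C4). [cite: Stark1974, Thm. 3] [cite: Murty1999StarkZeros, p. 512 (4)] -/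

noncomputable section

open scoped NumberField
open Complex NumberField Module

namespace Literature.NumberTheory.LFunctions.NumberField

open Literature.NumberTheory.LFunctions Literature.NumberTheory.QuadraticFields

/-- **A narrow table clears the quadratic Dedekind zeta functions of its range.** Under
`NoExceptionalZeroUpTo Q c₀`: for every quadratic number field `k` with `|d_k| ≤ Q` and every real
`σ` with `1 − c₀/log|d_k| ≤ σ` and `0 < σ < 1`, `ζ_k(σ) ≠ 0` (a real zero of `ζ_k` in `(0,1)` is a
zero of `L(s, κ)`, `κ` the primitive quadratic Kronecker character mod `|d_k| ≥ 3`).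
[cite: MontgomeryVaughan2007, §10.1 Exercise 26] -/
theorem dedekindZetaCont_quadratic_ne_zero_of_noExceptionalZeroUpTo {Q : ℕ} {c₀ : ℝ}
    (hN : NoExceptionalZeroUpTo Q c₀) (k : Type*) [Field k] [NumberField k]
    (h2 : finrank ℚ k = 2) (hkQ : (discr k).natAbs ≤ Q) {σ : ℝ}
    (hσ : 1 - c₀ / Real.log ((discr k).natAbs : ℝ) ≤ σ) (hσ0 : 0 < σ) (hσ1 : σ < 1) :
    dedekindZetaCont k σ ≠ 0 := by
  intro h0
  obtain ⟨M, _, κ, hM, hM3, -, hsq, hprim, hLz⟩ :=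
    Quadratic.exists_primitive_LFunction_eq_zero_of_realZero h2 hσ0 hσ1 h0
  subst hM
  exact hN _ hM3 hkQ κ (MulChar.isQuadratic_iff_sq_eq_one.mpr hsq) hprim σ hσ0 hσ hσ1.le hLz

/-- **The discriminant of a subfield is at most that of the field**: for number fields `k ⊆ K`,
`|d_k| ≤ |d_K|` (`|d_k|^{[K:k]} ∣ |d_K|`, `[K : k] ≥ 1`, `|d_K| ≠ 0`).
[cite: NeukirchANT1999, Ch. III Cor. (2.10)] -/
theorem natAbs_discr_le_of_algebra (k K : Type*) [Field k] [NumberField k] [Field K] [NumberField K]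
    [Algebra k K] : (discr k).natAbs ≤ (discr K).natAbs := by
  have hdvd := natAbs_discr_pow_finrank_dvd k K
  have hpos : 0 < Module.finrank k K := Module.finrank_pos
  have h1 : (discr k).natAbs ∣ (discr k).natAbs ^ Module.finrank k K :=
    dvd_pow_self _ hpos.ne'
  exact Nat.le_of_dvd (Int.natAbs_pos.mpr (discr_ne_zero K)) (h1.trans hdvd)

/-- **The quadratic-subfield form (narrow table).** Under `NoExceptionalZeroUpTo Q c₀` (`c₀ > 0`):
for every number field `K` of degree `n > 1` ALL OF WHOSE QUADRATIC SUBFIELDS `k` have `|d_k| ≤ Q`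
(no condition on `|d_K|`), and every real `σ` with `1 − min(c₀, 1/(4·n!))/log|d_K| ≤ σ < 1`:
`ζ_K(σ) ≠ 0`. (Stark: a zero there is a zero of `ζ_k` for a quadratic subfield `k`; `|d_k| ≤ |d_K|`
puts `σ` in the table's window for `k`.) [cite: Stark1974, Thm. 3] [cite: Murty1999StarkZeros, p. 512 (4)] -/
theorem dedekindZetaCont_ne_zero_of_noExceptionalZeroUpTo_of_quadraticSubfields {Q : ℕ} {c₀ : ℝ}
    (hN : NoExceptionalZeroUpTo Q c₀) (hc₀ : 0 < c₀) (K : Type) [Field K] [NumberField K]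
    (hK : 1 < finrank ℚ K)
    (hQ : ∀ k : IntermediateField ℚ K, finrank ℚ k = 2 → (discr k).natAbs ≤ Q) {σ : ℝ}
    (hσ : 1 - min c₀ (1 / (4 * ((finrank ℚ K).factorial : ℝ))) /
      Real.log ((discr K).natAbs : ℝ) ≤ σ)
    (hσ1 : σ < 1) : dedekindZetaCont K σ ≠ 0 := by
  set n : ℕ := finrank ℚ K with hn
  have hdK : 3 ≤ (discr K).natAbs := three_le_natAbs_discr K hK
  have hd3 : (3 : ℝ) ≤ ((discr K).natAbs : ℝ) := by exact_mod_cast hdK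
  have hlog3 : 1 < Real.log 3 := by
    have h := Real.exp_one_lt_d9
    rw [Real.lt_log_iff_exp_lt (by norm_num)]
    linarith
  have hlog : 1 < Real.log ((discr K).natAbs : ℝ) :=
    lt_of_lt_of_le hlog3 (Real.log_le_log (by norm_num) hd3)
  have hfac2 : (2 : ℝ) ≤ ((n).factorial : ℝ) := by
    have h := Nat.factorial_le (Nat.succ_le_of_lt hK)
    rw [Nat.factorial_two] at h
    exact_mod_cast h
  have hmin_c : min c₀ (1 / (4 * ((n).factorial : ℝ))) ≤ c₀ := min_le_left _ _
  have hmin_s : min c₀ (1 / (4 * ((n).factorial : ℝ))) ≤ 1 / (4 * ((n).factorial : ℝ)) :=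
    min_le_right _ _
  have hminpos : 0 < min c₀ (1 / (4 * ((n).factorial : ℝ))) := lt_min hc₀ (by positivity)
  -- Stark's window: `1 − 1/(4·n!·log d) ≤ σ`
  have hwin : 1 - 1 / (4 * ((n).factorial : ℝ) * Real.log ((discr K).natAbs : ℝ)) ≤ σ := by
    have h1 : min c₀ (1 / (4 * ((n).factorial : ℝ))) / Real.log ((discr K).natAbs : ℝ) ≤
        1 / (4 * ((n).factorial : ℝ)) / Real.log ((discr K).natAbs : ℝ) :=
      div_le_div_of_nonneg_right hmin_s (by linarith)
    rw [div_div] at h1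
    linarith
  refine dedekindZetaCont_ne_zero_of_forall_quadratic K hK hwin hσ1 fun k hk2 ↦ ?_
  -- the quadratic subfield `k`: `3 ≤ |d_k| ≤ |d_K|`, `|d_k| ≤ Q`
  have hkK : (discr k).natAbs ≤ (discr K).natAbs := natAbs_discr_le_of_algebra k K
  have hk1 : 1 < finrank ℚ k := by rw [hk2]; exact one_lt_two
  have hk3 : 3 ≤ (discr k).natAbs := three_le_natAbs_discr k hk1
  have hk3' : (3 : ℝ) ≤ ((discr k).natAbs : ℝ) := by exact_mod_cast hk3
  have hlogk : 0 < Real.log ((discr k).natAbs : ℝ) := Real.log_pos (by linarith)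
  have hlogkK : Real.log ((discr k).natAbs : ℝ) ≤ Real.log ((discr K).natAbs : ℝ) :=
    Real.log_le_log (by linarith) (by exact_mod_cast hkK)
  have hσ0 : 0 < σ := by
    have h4 : 1 / (4 * ((n).factorial : ℝ) * Real.log ((discr K).natAbs : ℝ)) < 1 := by
      rw [div_lt_one (by positivity)]; nlinarith
    linarith
  have hσk : 1 - c₀ / Real.log ((discr k).natAbs : ℝ) ≤ σ := by
    have h1 : min c₀ (1 / (4 * ((n).factorial : ℝ))) / Real.log ((discr K).natAbs : ℝ) ≤
        c₀ / Real.log ((discr K).natAbs : ℝ) :=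
      div_le_div_of_nonneg_right hmin_c (by linarith)
    have h2 : c₀ / Real.log ((discr K).natAbs : ℝ) ≤ c₀ / Real.log ((discr k).natAbs : ℝ) :=
      div_le_div_of_nonneg_left hc₀.le hlogk hlogkK
    linarith
  exact dedekindZetaCont_quadratic_ne_zero_of_noExceptionalZeroUpTo hN k hk2 (hQ k hk2) hσk hσ0 hσ1

/-- **The case `|d_K| ≤ Q`** (every subfield then has `|d_k| ≤ |d_K| ≤ Q`): under
`NoExceptionalZeroUpTo Q c₀` (`c₀ > 0`), for every number field `K` of degree `n > 1` with `|d_K| ≤ Q`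
and `1 − min(c₀, 1/(4·n!))/log|d_K| ≤ σ < 1`, `ζ_K(σ) ≠ 0` — the window of
`dedekindZetaCont_ne_zero_of_noExceptionalZeroUpTo` widened from `min(c₀,1)/(8·(2n)!)` to
`min(c₀, 1/(4·n!))`. [cite: Stark1974, Thm. 3] -/
theorem dedekindZetaCont_ne_zero_of_noExceptionalZeroUpTo' {Q : ℕ} {c₀ : ℝ}
    (hN : NoExceptionalZeroUpTo Q c₀) (hc₀ : 0 < c₀) (K : Type) [Field K] [NumberField K]
    (hK : 1 < finrank ℚ K) (hdQ : (discr K).natAbs ≤ Q) {σ : ℝ}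
    (hσ : 1 - min c₀ (1 / (4 * ((finrank ℚ K).factorial : ℝ))) /
      Real.log ((discr K).natAbs : ℝ) ≤ σ)
    (hσ1 : σ < 1) : dedekindZetaCont K σ ≠ 0 :=
  dedekindZetaCont_ne_zero_of_noExceptionalZeroUpTo_of_quadraticSubfields hN hc₀ K hK
    (fun k _ ↦ (natAbs_discr_le_of_algebra k K).trans hdQ) hσ hσ1

/-- **The quadratic-subfield form (wide table): Stark's whole window.** Under `NoRealZeroUpTo Q`:
for every number field `K` of degree `n > 1` all of whose quadratic subfields have `|d_k| ≤ Q`, and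
every real `σ` with `1 − 1/(4·n!·log|d_K|) ≤ σ < 1`: `ζ_K(σ) ≠ 0`. [cite: Stark1974, Thm. 3]
[cite: Murty1999StarkZeros, p. 512 (4)] -/
theorem dedekindZetaCont_ne_zero_of_noRealZeroUpTo_of_quadraticSubfields {Q : ℕ}
    (hW : NoRealZeroUpTo Q) (K : Type) [Field K] [NumberField K] (hK : 1 < finrank ℚ K)
    (hQ : ∀ k : IntermediateField ℚ K, finrank ℚ k = 2 → (discr k).natAbs ≤ Q) {σ : ℝ}
    (hσ : 1 - 1 / (4 * ((finrank ℚ K).factorial : ℝ) * Real.log ((discr K).natAbs : ℝ)) ≤ σ)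
    (hσ1 : σ < 1) : dedekindZetaCont K σ ≠ 0 := by
  refine dedekindZetaCont_ne_zero_of_noExceptionalZeroUpTo_of_quadraticSubfields
    (hW.noExceptionalZeroUpTo 1) one_pos K hK hQ ?_ hσ1
  have hfac : (0 : ℝ) < 4 * ((finrank ℚ K).factorial : ℝ) := by positivity
  have h14 : 1 / (4 * ((finrank ℚ K).factorial : ℝ)) ≤ 1 := by
    rw [div_le_one hfac]
    have : (1 : ℝ) ≤ ((finrank ℚ K).factorial : ℝ) := by
      exact_mod_cast Nat.succ_le_of_lt (Nat.factorial_pos _)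
    linarith
  rwa [min_eq_right h14, div_div]

/-- **When the narrow table is at least as wide as Stark's window** (`1/(4·n!) ≤ c₀`, e.g. `c₀ = 1/5`
and any `n ≥ 2`): under `NoExceptionalZeroUpTo Q c₀`, for every number field `K` of degree `n > 1`
all of whose quadratic subfields have `|d_k| ≤ Q`, `ζ_K(σ) ≠ 0` on Stark's WHOLE window
`1 − 1/(4·n!·log|d_K|) ≤ σ < 1`. [cite: Stark1974, Thm. 3] -/
theorem dedekindZetaCont_ne_zero_starkWindow_of_noExceptionalZeroUpTo {Q : ℕ} {c₀ : ℝ}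
    (hN : NoExceptionalZeroUpTo Q c₀) (K : Type) [Field K] [NumberField K] (hK : 1 < finrank ℚ K)
    (hc : 1 / (4 * ((finrank ℚ K).factorial : ℝ)) ≤ c₀)
    (hQ : ∀ k : IntermediateField ℚ K, finrank ℚ k = 2 → (discr k).natAbs ≤ Q) {σ : ℝ}
    (hσ : 1 - 1 / (4 * ((finrank ℚ K).factorial : ℝ) * Real.log ((discr K).natAbs : ℝ)) ≤ σ)
    (hσ1 : σ < 1) : dedekindZetaCont K σ ≠ 0 := by
  have hpos : 0 < 1 / (4 * ((finrank ℚ K).factorial : ℝ)) := by positivity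
  refine dedekindZetaCont_ne_zero_of_noExceptionalZeroUpTo_of_quadraticSubfields hN
    (lt_of_lt_of_le hpos hc) K hK hQ ?_ hσ1
  rwa [min_eq_right hc, div_div]

end Literature.NumberTheory.LFunctions.NumberField

end
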